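import Mathlib

/-!
# The abstract port problem of THEOREM R, GENERAL FORM: zone ports and arbitrary multiplicities (p6, gen 24)

mine-3's THEOREM R (proofs/C-041.md §3 / §6 (a)) reduces ROW C-041 `(G⅔)` on the sources with internally
red-connected attachments, per colouring of `G⁺ = H − {1, 2}`, to an abstract port problem whose PORTS are the rc
ZONES (vertex sets, passable as a whole, deleted as a whole) carrying any number of terminal edges.  The singleton
version (`C041PortProblemDefs` … `C041PortProblemLemma`: one vertex per port, at most one 1-edge and one 2-edge) is the
special case `Z = image singleton M`, `E = V × Bool`.  This file has the general definitions and the gate facts: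

* a `Problem V E`: a symmetric graph `adj` on `V`, a ROOT SET `root` (the original problem has `root = {c}`; the
  sub-problem of case (v) is rooted at the unique gate zone), the zones `Z : Finset (Finset V)` — pairwise disjoint,
  disjoint from the root, INTERNALLY CONNECTED (the rc hypothesis) — and the terminal edges, named by `E`: `tv e` the
  vertex carrying `e`, `ts e` its side (`false` = 1-edge, `true` = 2-edge), `tz e ∋ tv e` the zone of that vertex;
  `P.Term = {e // tz e ∈ Z}` are the edges at the ports; `sw C` = the zone is switchable; every zone has an edge;
* a PATTERN `x : P.Term → Bool` (`true` = red); `Adm x`: a non-switchable zone has all its edges red, no zone has a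
  blue 1-edge and a blue 2-edge; `A_t x` = the union of the zones with a blue `t`-edge (DELETED on side `t`);
  `X_t x` = some red `t`-edge; `Good₁ x` = some red 2-edge is carried by a vertex reached from the root set avoiding
  `A₁ x` (`Good₂` symmetric); `weight x = 3·[Good₁] + 3·[Good₂] − 2`; `Φ∨ P`, `Φ∧ P` the weight sums over the
  admissible patterns with `X₁ ∨ X₂` resp. `X₁ ∧ X₂`;
* `Reach`, `reach_anti` (S2), `good₁_X₂` / `good₂_X₁` (S3), the port-free reach `R₀`, the GATES (zones adjacent to
  `R₀`), `exists_gate_of_reflTransGen` (S1) and THE KEY FACT `reach_gate`: every vertex of a gate zone not deleted is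
  reached from the root set avoiding the deleted set — through the port-free path to the zone and inside it by
  internal connectivity;
* the weight sums `Φ∨ P`, `Φ∧ P`.  Case (iii) of THE LEMMA (a non-switchable gate) is `C041ZonePortForced`.
-/

namespace PercRepro

namespace ZonePort

open Finset

/-- A zone port problem: a symmetric graph on `V`, a root set, pairwise disjoint internally connected zones
disjoint from the root, and terminal edges named by `E` (`tv` the vertex, `ts` the side, `tz` the zone of the vertex);
`sw` marks the switchable zones; every zone carries an edge. -/
structure Problem (V E : Type*) where
  /-- the graph -/
  adj : V → V → Prop
  /-- the graph is undirected -/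
  symm : ∀ x y, adj x y → adj y x
  /-- the root set -/
  root : Finset V
  /-- the zones (the ports) -/
  Z : Finset (Finset V)
  /-- the zones are pairwise disjoint -/
  hdisj : ∀ C ∈ Z, ∀ D ∈ Z, C ≠ D → ∀ v ∈ C, v ∉ D
  /-- the root set meets no zone -/
  hroot : ∀ C ∈ Z, ∀ v ∈ C, v ∉ root
  /-- every zone is internally connected -/
  hzconn : ∀ C ∈ Z, ∀ u ∈ C, ∀ w ∈ C,
    Relation.ReflTransGen (fun a b => adj a b ∧ a ∈ C ∧ b ∈ C) u w
  /-- the vertex carrying a terminal edge -/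
  tv : E → V
  /-- the side of a terminal edge: `false` = 1-edge, `true` = 2-edge -/
  ts : E → Bool
  /-- the zone of the vertex carrying a terminal edge -/
  tz : E → Finset V
  /-- the vertex lies in its zone -/
  htv : ∀ e, tv e ∈ tz e
  /-- the zone is switchable (its terminal edges may be blue) -/
  sw : Finset V → Bool
  /-- every zone carries a terminal edge -/
  hk : ∀ C ∈ Z, ∃ e, tz e = C

namespace Problem

variable {V E : Type*}

/-- The terminal edges at the ports. -/
abbrev Term (P : Problem V E) : Type _ := {e : E // P.tz e ∈ P.Z}

/-- The port vertices: the union of the zones. -/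
def PV (P : Problem V E) : Set V := {v | ∃ C ∈ P.Z, v ∈ C}

/-- A pattern is admissible when every edge of a non-switchable zone is red and no zone carries a blue 1-edge
together with a blue 2-edge. -/
def Adm (P : Problem V E) (x : P.Term → Bool) : Prop :=
  (∀ e : P.Term, P.sw (P.tz e.1) = false → x e = true) ∧
  (∀ e f : P.Term, P.tz e.1 = P.tz f.1 → P.ts e.1 = false → P.ts f.1 = true → x e = true ∨ x f = true)

/-- The vertices deleted on side `1`: the zones with a blue 1-edge. -/
def A₁ (P : Problem V E) (x : P.Term → Bool) : Set V :=
  {v | ∃ e : P.Term, P.ts e.1 = false ∧ x e = false ∧ v ∈ P.tz e.1}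

/-- The vertices deleted on side `2`: the zones with a blue 2-edge. -/
def A₂ (P : Problem V E) (x : P.Term → Bool) : Set V :=
  {v | ∃ e : P.Term, P.ts e.1 = true ∧ x e = false ∧ v ∈ P.tz e.1}

/-- `P.Reach A u v`: a path from `u` to `v` in the graph none of whose vertices lies in `A`. -/
def Reach (P : Problem V E) (A : Set V) (u v : V) : Prop :=
  u ∉ A ∧ Relation.ReflTransGen (fun a b => P.adj a b ∧ b ∉ A) u v

/-- `P.RReach A v`: `v` is reached from the root set avoiding `A`. -/
def RReach (P : Problem V E) (A : Set V) (v : V) : Prop := ∃ u ∈ P.root, P.Reach A u v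

/-- Some red 1-edge. -/
def X₁ (P : Problem V E) (x : P.Term → Bool) : Prop := ∃ e : P.Term, P.ts e.1 = false ∧ x e = true

/-- Some red 2-edge. -/
def X₂ (P : Problem V E) (x : P.Term → Bool) : Prop := ∃ e : P.Term, P.ts e.1 = true ∧ x e = true

/-- `Good₁`: a red 2-edge is carried by a vertex reached from the root set avoiding the zones deleted on side `1`. -/
def Good₁ (P : Problem V E) (x : P.Term → Bool) : Prop :=
  ∃ e : P.Term, P.ts e.1 = true ∧ x e = true ∧ P.RReach (P.A₁ x) (P.tv e.1)

/-- `Good₂`: a red 1-edge is carried by a vertex reached from the root set avoiding the zones deleted on side `2`. -/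
def Good₂ (P : Problem V E) (x : P.Term → Bool) : Prop :=
  ∃ e : P.Term, P.ts e.1 = false ∧ x e = true ∧ P.RReach (P.A₂ x) (P.tv e.1)

open Classical in
/-- The weight of a pattern: `3·[Good₁] + 3·[Good₂] − 2`. -/
noncomputable def weight (P : Problem V E) (x : P.Term → Bool) : ℤ :=
  (if P.Good₁ x then 3 else 0) + (if P.Good₂ x then 3 else 0) - 2

/-- The port-free reach `R₀` of the root set. -/
def R₀ (P : Problem V E) : Set V := {v | P.RReach P.PV v}

/-- The gates: the zones adjacent to the port-free reach. -/
def IsGate (P : Problem V E) (C : Finset V) : Prop := C ∈ P.Z ∧ ∃ r ∈ P.R₀, ∃ u ∈ C, P.adj r u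

/-- Every zone is reached from the root set (the connectivity hypothesis of THE LEMMA). -/
def ZonesReached (P : Problem V E) : Prop :=
  ∀ C ∈ P.Z, ∃ u ∈ P.root, ∃ w ∈ C, Relation.ReflTransGen P.adj u w

section Basic

variable {P : Problem V E}

/-- Monotonicity of the reflexive-transitive closure in the relation. -/
theorem reflTransGen_mono {α : Type*} {r s : α → α → Prop} (hrs : ∀ a b, r a b → s a b) {u v : α}
    (huv : Relation.ReflTransGen r u v) : Relation.ReflTransGen s u v := by
  induction huv with
  | refl => exact Relation.ReflTransGen.refl
  | tail _ hbc ih => exact ih.tail (hrs _ _ hbc)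

/-- **S2**: avoiding more is harder. -/
theorem reach_anti {A B : Set V} (hAB : A ⊆ B) {u v : V} (h : P.Reach B u v) : P.Reach A u v := by
  obtain ⟨hu, hw⟩ := h
  refine ⟨fun hu' => hu (hAB hu'), ?_⟩
  induction hw with
  | refl => exact Relation.ReflTransGen.refl
  | tail _ hbc ih => exact ih.tail ⟨hbc.1, fun hb => hbc.2 (hAB hb)⟩

/-- **S2** from the root set. -/
theorem rreach_anti {A B : Set V} (hAB : A ⊆ B) {v : V} (h : P.RReach B v) : P.RReach A v := by
  obtain ⟨u, hu, h⟩ := h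
  exact ⟨u, hu, reach_anti hAB h⟩

/-- The end of an avoiding path is not in the avoided set. -/
theorem Reach.end_not_mem {A : Set V} {u v : V} (h : P.Reach A u v) : v ∉ A := by
  rcases Relation.ReflTransGen.cases_tail h.2 with h' | ⟨_, _, hbc⟩
  · exact h' ▸ h.1
  · exact hbc.2

/-- The end of a path from the root set is not in the avoided set. -/
theorem RReach.end_not_mem {A : Set V} {v : V} (h : P.RReach A v) : v ∉ A := by
  obtain ⟨_, _, h⟩ := h
  exact h.end_not_mem

/-- Avoiding paths compose. -/
theorem Reach.trans {A : Set V} {u v w : V} (h₁ : P.Reach A u v) (h₂ : P.Reach A v w) :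
    P.Reach A u w :=
  ⟨h₁.1, h₁.2.trans h₂.2⟩

/-- A path from the root set composes with an avoiding path. -/
theorem RReach.trans {A : Set V} {v w : V} (h₁ : P.RReach A v) (h₂ : P.Reach A v w) :
    P.RReach A w := by
  obtain ⟨u, hu, h₁⟩ := h₁
  exact ⟨u, hu, h₁.trans h₂⟩

/-- A single step. -/
theorem Reach.single {A : Set V} {u v : V} (hu : u ∉ A) (hv : v ∉ A) (h : P.adj u v) :
    P.Reach A u v :=
  ⟨hu, Relation.ReflTransGen.single ⟨h, hv⟩⟩

/-- The empty path. -/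
theorem Reach.refl {A : Set V} {u : V} (hu : u ∉ A) : P.Reach A u u :=
  ⟨hu, Relation.ReflTransGen.refl⟩

/-- An avoiding path is a path. -/
theorem Reach.reflTransGen {A : Set V} {u v : V} (h : P.Reach A u v) :
    Relation.ReflTransGen P.adj u v := by
  obtain ⟨_, hw⟩ := h
  induction hw with
  | refl => exact Relation.ReflTransGen.refl
  | tail _ hbc ih => exact ih.tail hbc.1

/-- **Inside a zone**: a path inside a zone disjoint from `A` is an avoiding path. -/
theorem reach_of_zone {A : Set V} {C : Finset V} (hC : C ∈ P.Z) (hCA : ∀ v ∈ C, v ∉ A) {u w : V}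
    (hu : u ∈ C) (hw : w ∈ C) : P.Reach A u w :=
  ⟨hCA u hu, reflTransGen_mono (fun _ _ hab => ⟨hab.1, hCA _ hab.2.2⟩) (P.hzconn C hC u hu w hw)⟩

/-- **S3**: `Good₁` gives a red 2-edge. -/
theorem good₁_X₂ {x : P.Term → Bool} (h : P.Good₁ x) : P.X₂ x := by
  obtain ⟨e, he, hx, _⟩ := h
  exact ⟨e, he, hx⟩

/-- **S3**: `Good₂` gives a red 1-edge. -/
theorem good₂_X₁ {x : P.Term → Bool} (h : P.Good₂ x) : P.X₁ x := by
  obtain ⟨e, he, hx, _⟩ := h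
  exact ⟨e, he, hx⟩

/-- The zone of a term is a zone. -/
theorem tz_mem (e : P.Term) : P.tz e.1 ∈ P.Z := e.2

/-- The vertex of a term is a port vertex. -/
theorem tv_mem_PV (e : P.Term) : P.tv e.1 ∈ P.PV := ⟨P.tz e.1, e.2, P.htv e.1⟩

/-- The deleted vertices are port vertices. -/
theorem A₁_subset (x : P.Term → Bool) : P.A₁ x ⊆ P.PV := by
  rintro v ⟨e, _, _, hv⟩
  exact ⟨P.tz e.1, e.2, hv⟩

/-- The deleted vertices are port vertices. -/
theorem A₂_subset (x : P.Term → Bool) : P.A₂ x ⊆ P.PV := by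
  rintro v ⟨e, _, _, hv⟩
  exact ⟨P.tz e.1, e.2, hv⟩

/-- A root vertex is not a port vertex. -/
theorem not_mem_PV_of_mem_root {u : V} (hu : u ∈ P.root) : u ∉ P.PV := by
  rintro ⟨C, hC, huC⟩
  exact P.hroot C hC u huC hu

/-- The root set is in its port-free reach. -/
theorem root_subset_R₀ {u : V} (hu : u ∈ P.root) : u ∈ P.R₀ :=
  ⟨u, hu, Reach.refl (not_mem_PV_of_mem_root hu)⟩

/-- The port-free reach contains no port vertex. -/
theorem not_mem_PV_of_mem_R₀ {v : V} (hv : v ∈ P.R₀) : v ∉ P.PV := RReach.end_not_mem hv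

/-- A zone vertex is not in the port-free reach. -/
theorem not_mem_R₀_of_mem_zone {C : Finset V} (hC : C ∈ P.Z) {v : V} (hv : v ∈ C) : v ∉ P.R₀ :=
  fun h => not_mem_PV_of_mem_R₀ h ⟨C, hC, hv⟩

/-- **The first port on a path**: a path from the root set to a vertex ends in `R₀` or passes a gate. -/
theorem mem_R₀_or_exists_gate {u v : V} (hu : u ∈ P.root) (h : Relation.ReflTransGen P.adj u v) :
    v ∈ P.R₀ ∨ ∃ C, P.IsGate C := by
  induction h with
  | refl => exact Or.inl (root_subset_R₀ hu)
  | @tail b d _ hbd ih =>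
    rcases ih with hb | hq
    · by_cases hd : d ∈ P.PV
      · obtain ⟨C, hC, hdC⟩ := hd
        exact Or.inr ⟨C, hC, b, hb, d, hdC, hbd⟩
      · obtain ⟨u', hu', hb'⟩ := hb
        exact Or.inl ⟨u', hu', hb'.1, hb'.2.tail ⟨hbd, hd⟩⟩
    · exact Or.inr hq

/-- **S1**: a path from the root set to a zone vertex passes a gate. -/
theorem exists_gate_of_reflTransGen {C : Finset V} (hC : C ∈ P.Z) {u w : V} (hu : u ∈ P.root) (hw : w ∈ C)
    (h : Relation.ReflTransGen P.adj u w) : ∃ D, P.IsGate D := by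
  rcases mem_R₀_or_exists_gate hu h with hR | hq
  · exact absurd hR (not_mem_R₀_of_mem_zone hC hw)
  · exact hq

/-- **S1**: if every zone is reached and a zone exists, a gate exists. -/
theorem gates_nonempty (hconn : P.ZonesReached) (hZ : P.Z.Nonempty) : ∃ D, P.IsGate D := by
  obtain ⟨C, hC⟩ := hZ
  obtain ⟨u, hu, w, hw, h⟩ := hconn C hC
  exact exists_gate_of_reflTransGen hC hu hw h

/-- A gate is a zone. -/
theorem IsGate.mem {C : Finset V} (hC : P.IsGate C) : C ∈ P.Z := hC.1

/-- **THE KEY FACT**: every vertex of a gate zone disjoint from `A ⊆ PV` is reached from the root set avoiding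
`A` — the port-free path to the zone meets no port vertex, hence nothing of `A`, and the zone is internally
connected. -/
theorem reach_gate {A : Set V} (hA : A ⊆ P.PV) {C : Finset V} (hC : P.IsGate C) (hCA : ∀ v ∈ C, v ∉ A)
    {w : V} (hw : w ∈ C) : P.RReach A w := by
  obtain ⟨hCZ, r, hr, u, hu, hru⟩ := hC
  have hr' : P.RReach A r := rreach_anti hA hr
  exact (hr'.trans (Reach.single hr'.end_not_mem (hCA u hu) hru)).trans (reach_of_zone hCZ hCA hu hw)

/-- A zone with no blue 1-edge is disjoint from `A₁ x`. -/
theorem zone_disjoint_A₁ {x : P.Term → Bool} {C : Finset V} (hC : C ∈ P.Z)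
    (h : ∀ e : P.Term, P.tz e.1 = C → P.ts e.1 = false → x e = true) : ∀ v ∈ C, v ∉ P.A₁ x := by
  rintro v hv ⟨e, he, hxe, hve⟩
  by_cases hCe : P.tz e.1 = C
  · rw [h e hCe he] at hxe
    exact Bool.noConfusion hxe
  · exact P.hdisj C hC (P.tz e.1) e.2 (Ne.symm hCe) v hv hve

/-- A zone with no blue 2-edge is disjoint from `A₂ x`. -/
theorem zone_disjoint_A₂ {x : P.Term → Bool} {C : Finset V} (hC : C ∈ P.Z)
    (h : ∀ e : P.Term, P.tz e.1 = C → P.ts e.1 = true → x e = true) : ∀ v ∈ C, v ∉ P.A₂ x := by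
  rintro v hv ⟨e, he, hxe, hve⟩
  by_cases hCe : P.tz e.1 = C
  · rw [h e hCe he] at hxe
    exact Bool.noConfusion hxe
  · exact P.hdisj C hC (P.tz e.1) e.2 (Ne.symm hCe) v hv hve

/-- A zone with a blue 1-edge is deleted on side `1`. -/
theorem zone_subset_A₁ {x : P.Term → Bool} {e : P.Term} (he : P.ts e.1 = false) (hxe : x e = false) :
    ∀ v ∈ P.tz e.1, v ∈ P.A₁ x := fun _ hv => ⟨e, he, hxe, hv⟩

/-- A zone with a blue 2-edge is deleted on side `2`. -/
theorem zone_subset_A₂ {x : P.Term → Bool} {e : P.Term} (he : P.ts e.1 = true) (hxe : x e = false) :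
    ∀ v ∈ P.tz e.1, v ∈ P.A₂ x := fun _ hv => ⟨e, he, hxe, hv⟩

/-- **A red 1-edge at a gate with no blue 2-edge gives `Good₂`.** -/
theorem good₂_of_red_gate {x : P.Term → Bool} {e : P.Term} (hC : P.IsGate (P.tz e.1)) (he : P.ts e.1 = false)
    (hx : x e = true) (h2 : ∀ f : P.Term, P.tz f.1 = P.tz e.1 → P.ts f.1 = true → x f = true) : P.Good₂ x :=
  ⟨e, he, hx, reach_gate (A₂_subset x) hC (zone_disjoint_A₂ e.2 h2) (P.htv e.1)⟩

/-- **A red 2-edge at a gate with no blue 1-edge gives `Good₁`.** -/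
theorem good₁_of_red_gate {x : P.Term → Bool} {e : P.Term} (hC : P.IsGate (P.tz e.1)) (he : P.ts e.1 = true)
    (hx : x e = true) (h1 : ∀ f : P.Term, P.tz f.1 = P.tz e.1 → P.ts f.1 = false → x f = true) : P.Good₁ x :=
  ⟨e, he, hx, reach_gate (A₁_subset x) hC (zone_disjoint_A₁ e.2 h1) (P.htv e.1)⟩

open Classical in
/-- A Good side gives weight `≥ 1`. -/
theorem one_le_weight_of_good {x : P.Term → Bool} (h : P.Good₁ x ∨ P.Good₂ x) : 1 ≤ P.weight x := by
  unfold weight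
  rcases h with h | h
  · rw [if_pos h]
    split_ifs <;> omega
  · rw [if_pos h]
    split_ifs <;> omega

open Classical in
/-- Both sides Good give weight `4`. -/
theorem weight_eq_four_of_good {x : P.Term → Bool} (h₁ : P.Good₁ x) (h₂ : P.Good₂ x) : P.weight x = 4 := by
  unfold weight
  rw [if_pos h₁, if_pos h₂]
  norm_num

open Classical in
/-- The weight is at least `−2`. -/
theorem neg_two_le_weight (x : P.Term → Bool) : -2 ≤ P.weight x := by
  unfold weight
  split_ifs <;> omega

end Basic

section Sums

variable [Fintype E] [DecidableEq E] [DecidableEq V] {P : Problem V E}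

open Classical in
/-- `Φ∨ P`: the weight sum over the admissible patterns with a red terminal edge (`X₁ ∨ X₂`). -/
noncomputable def phiOr (P : Problem V E) : ℤ :=
  ∑ x : P.Term → Bool, if P.Adm x ∧ (P.X₁ x ∨ P.X₂ x) then P.weight x else 0

open Classical in
/-- `Φ∧ P`: the weight sum over the admissible patterns with a red 1-edge and a red 2-edge (`X₁ ∧ X₂`). -/
noncomputable def phiAnd (P : Problem V E) : ℤ :=
  ∑ x : P.Term → Bool, if P.Adm x ∧ (P.X₁ x ∧ P.X₂ x) then P.weight x else 0

end Sums

end Problem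

end ZonePort

end PercRepro
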